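import Summits.QuantumFields.YangMills.Theorems.UnitScaleTiltProp7CornerCombInCellLetters
import HarnessLib

/-!
# (n3)-COMB (II) «COMB = STRAIGHT ∘ BLOCK-AXIAL», file F-6a-2: THE COVARIANT IN-CELL ROW — the cornered comb-tree functional `F̂_V(q)` ((112) p.34) minus its DRIFT `Σ_μ (n∕2)·X̄^{cov}_μ(q)` is an
# OSCILLATION: `‖F̂ − drift‖² ≤ c₁(d,n,N)·(covariant gradient energy on the block) + c₂(d,n,N)·a²·(mass on the block)` (PREREAD §1 (a) dressed; MASTER §1 row 6)

Crux `stmt-QuantumFields-19200` `MinimiserStabilityRegPr`, route-R E′ (A′)-on-Σ, P-A2 (β); the displayed route-internal row `hMcomb` (SIGNATURE-0; RULINGS №19 O4 ∕ №22; OPEN, XL) and its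
supplier design (II) (★★OWNER «(II) GO» of record 2026-08-29T06:31:31Z; pen F-6a named by ★routeR-w1 g9 07:15:27Z).  Seat ym-routeR-w6 g8; `--kind proof --supports stmt-QuantumFields-19200
--as helper`; THEOREMS ONLY; «(O2) groundwork — not consumed by any displayed row before the freeze lifts»; count-neutral.  YM₃ on T³ is a ladder rung (R3), not Clay; nothing here is
progress on the YM mass gap.

OBJECTS (lit letters on `ℤᵈ`, `𝔸 = M_N(ℂ)`): `U1` background `V` with unit plaquettes within `a` of `1` ((44)); level field `X`; block `B(q) = q + [0,n]ᵈ` (side `L = n+1`); comb-transported field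
`Xᵀ(y,μ) = R(V(Γ_{q,y}))X(y,μ)` and its block means `X̄_μ(q) = (n+1)⁻ᵈ Σ_s R(V(Γ_{q,q+s}))X(q+s, μ)` (★routeR-w1's `X̄^{cov}_μ` token for token); `F̂ = FhatCov (n+1) V X q` ((112)).
* `asum_const_tw`, `asum_const_treeWord_boxVec` — the abelian functional of a site-constant bond function over `Γ_{q,q+s}` is `Σ_μ s_μ•c_μ`; `two_mul_sum_coord`, `sum_coord` — `Σ_{s∈[0,n]ᵈ} s_μ =
  (n+1)ᵈ·n∕2` (the involution `s_μ ↦ n − s_μ`); hence the DRIFT WEIGHTS `(n+1)⁻ᵈΣ_s s_μ = n∕2 = (L−1)∕2`;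
* ★★★ `norm_FhatCov_sub_drift_sq_le` — THE IN-CELL ROW:
  `‖F̂ − Σ_μ (n∕2)•X̄_μ(q)‖² ≤ (N∕2)d²n²(n+1)²·Σ_{μ,ν}Σ_{s:s_ν<n}‖R(V(q+s,ν))X(q+s+e_ν,μ) − X(q+s,μ)‖² + (8d⁶n⁶ + 2N·d⁵n⁴(n+1)²)·a²·Σ_{s,μ}‖X(q+s,μ)‖²`.
  ROUTE: `F̂ − drift = (n+1)⁻ᵈΣ_r [(R_{0,q}X)(Γ_r) − A[Xᵀ](Γ_r)] + (n+1)⁻ᵈΣ_r A[Xᵀ − X̄](Γ_r)` (F-6a-1 §1 + `asum_sub`); the first bracket `≤ 2d³n³a√mass` (transport defects, F-6a-1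
  ★`norm_conjR_tsum_sub_asum_le`), the second `≤ dn·√OSC` (single term ≤ block sum); `OSC ≤ (N∕8)(n+1)²Σ‖ΔXᵀ‖²` (cube Poincaré with the mean) and `‖ΔXᵀ‖ ≤ ‖∇^{cov}X‖ + 2dna‖X‖` (F-6a-1
  ★`norm_conjR_tree_sub_le`).  CONSTANTS polynomial in `(d, n, N)` ONLY — VERDICT (g1)(g2): no level, no `k`, no torus, no `K`, no member.
NOT HERE: the scale chain (✓II-3), sums over corners, Weitzenböck (F-6c∕F-6d).  HONEST: lattice analysis at one block; nothing of `hMcomb` ∕ `hMcomb₂` ∕ (β) ∕ `hD` ∕ hPA2 ∕ hcoS ∕ E′ ∕ EX ∕ the crux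
is proved or claimed; rung R3 (YM₃ on T³), NOT d = 4, NOT infinite volume, NOT Clay; YM gap NOT proved.
-/

set_option autoImplicit false

open scoped BigOperators Matrix.Norms.L2Operator

namespace Summit.QuantumFields.YangMills.Theorems.Prop7CornerCombInCellPoincare

open Literature.MathematicalPhysics.QuantumFieldTheory.Balaban1983to89
open Finset
open B7Prop1Explicit renaming Site → LSite
open B7Prop1Explicit (Letter e hol treeWord disp plaqWord l1 U1 hol_mem boxVec asum asum_cons asum_nil asum_append stepA seg_natCast disp_seg treeWord_zero hol_nil)
open B7Eq78Linearization (conjR conjR_apply conjR_sub)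
open B8Ineq132 (norm_conjR one_conjR)
open B7Prop3GeneralRotated (tsum)
open B7Prop3GeneralLinear (FhatCov)
open B7Prop4Flat (asum_sub)
open B8Lemma1NonAbelian (tw tw_cons tw_nil treeWord_eq_tw)
open Beta.CoordCubePoincare (stepUp)
open Summit.QuantumFields.YangMills.Theorems.Prop7CovariantCoercivity (intVec_stepUp l1_intVec_le)
open Summit.QuantumFields.YangMills.Theorems.Prop7CornerCombInCellLetters

variable {d N : ℕ} [NeZero N]

/-! ## §1 The drift weights: the abelian functional of a site-constant field over a tree word, and `Σ_{s∈[0,n]ᵈ} s_μ = (n+1)ᵈ·n∕2` -/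

omit [NeZero N] in
/-- Over a tree word on the directions `ks` with non-negative integer runs, the abelian functional of a SITE-CONSTANT bond function `(y, μ) ↦ c_μ` is `Σ_{κ∈ks} v_κ • c_κ` (any base point).
[cite: Balaban1985Averaging, p.24] -/
theorem asum_const_tw (c : Fin d → Matrix (Fin N) (Fin N) ℂ) (v : Fin d → ℕ) :
    ∀ (ks : List (Fin d)) (x : LSite d), asum (fun _ μ => c μ) x (tw ks fun κ => (v κ : ℤ)) = (ks.map fun κ => (v κ : ℝ) • c κ).sum
  | [], x => by simp
  | κ :: ks, x => by
    rw [tw_cons, asum_append, asum_const_tw c v ks, List.map_cons, List.sum_cons]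
    congr 1
    -- a straight run of `v κ` positive letters
    have hseg : ∀ (m : ℕ) (y : LSite d), asum (fun _ μ => c μ) y (B7Prop1Explicit.seg κ (m : ℤ)) = (m : ℝ) • c κ := by
      intro m
      induction m with
      | zero => intro y; simp
      | succ m ih =>
        intro y
        rw [seg_natCast, List.replicate_succ, asum_cons, ← seg_natCast, ih]
        simp only [stepA, ↓reduceIte, Nat.cast_succ, add_smul, one_smul, add_comm]
    exact hseg (v κ) x

omit [NeZero N] in
/-- In particular over `Γ_{q, q+s}`, `s ∈ [0,n]ᵈ`: `A[(y,μ) ↦ c_μ](Γ_{q,q+s}) = Σ_μ s_μ • c_μ`. [cite: Balaban1985Averaging, p.24] -/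
theorem asum_const_treeWord_boxVec {n : ℕ} (c : Fin d → Matrix (Fin N) (Fin N) ℂ) (q : LSite d) (s : Fin d → Fin (n + 1)) :
    asum (fun _ μ => c μ) q (treeWord (boxVec (n + 1) s)) = ∑ μ : Fin d, ((s μ : ℕ) : ℝ) • c μ := by
  have h := asum_const_tw c (fun κ => (s κ : ℕ)) (List.finRange d).reverse q
  have hb : (fun κ => (((fun κ => (s κ : ℕ)) κ : ℕ) : ℤ)) = boxVec (n + 1) s := funext fun κ => rfl
  rw [hb, ← treeWord_eq_tw] at h
  rw [h, List.map_reverse, List.sum_reverse, Fin.sum_univ_def]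

/-- **`2·Σ_{s∈[0,n]ᵈ} s_μ = n·(n+1)ᵈ`** by the involution `s_μ ↦ n − s_μ` (`Fin.rev` in the coordinate `μ`). [folklore] -/
theorem two_mul_sum_coord (n : ℕ) (μ : Fin d) :
    2 * ∑ s : Fin d → Fin (n + 1), ((s μ : ℕ) : ℝ) = n * ((n : ℝ) + 1) ^ d := by
  classical
  set f : (Fin d → Fin (n + 1)) → (Fin d → Fin (n + 1)) := fun s => Function.update s μ (s μ).rev with hf
  have hinv : Function.Involutive f := fun s => by
    simp only [hf, Function.update_self, Fin.rev_rev, Function.update_idem, Function.update_eq_self]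
  have hre : ∑ s : Fin d → Fin (n + 1), ((s μ : ℕ) : ℝ) = ∑ s : Fin d → Fin (n + 1), (((f s) μ : ℕ) : ℝ) :=
    (Equiv.sum_comp hinv.toPerm (fun s : Fin d → Fin (n + 1) => ((s μ : ℕ) : ℝ))).symm
  have hval : ∀ s : Fin d → Fin (n + 1), (((f s) μ : ℕ) : ℝ) = n - ((s μ : ℕ) : ℝ) := fun s => by
    simp only [hf, Function.update_self, Fin.val_rev]
    have := (s μ).isLt
    rw [Nat.cast_sub (by omega)]
    push_cast; ring
  have hcard : (Fintype.card (Fin d → Fin (n + 1)) : ℝ) = ((n : ℝ) + 1) ^ d := by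
    rw [Fintype.card_fun, Fintype.card_fin, Fintype.card_fin]; push_cast; ring
  calc 2 * ∑ s : Fin d → Fin (n + 1), ((s μ : ℕ) : ℝ)
        = ∑ s : Fin d → Fin (n + 1), ((s μ : ℕ) : ℝ) + ∑ s : Fin d → Fin (n + 1), (((f s) μ : ℕ) : ℝ) := by rw [← hre]; ring
    _ = ∑ s : Fin d → Fin (n + 1), (n : ℝ) := by rw [← Finset.sum_add_distrib]; exact Finset.sum_congr rfl fun s _ => by rw [hval]; ring
    _ = n * ((n : ℝ) + 1) ^ d := by rw [Finset.sum_const, Finset.card_univ, nsmul_eq_mul, hcard]; ring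

/-- **THE DRIFT WEIGHT**: `(n+1)⁻ᵈ·Σ_{s∈[0,n]ᵈ} s_μ = n∕2 = (L−1)∕2` — the mean number of `μ`-bonds of the cornered comb tree. [cite: Balaban1985Averaging, p.24] -/
theorem sum_coord (n : ℕ) (μ : Fin d) : (((n : ℝ) + 1) ^ d)⁻¹ * ∑ s : Fin d → Fin (n + 1), ((s μ : ℕ) : ℝ) = n / 2 := by
  have h := two_mul_sum_coord (d := d) n μ
  have hpos : (0 : ℝ) < ((n : ℝ) + 1) ^ d := by positivity
  field_simp
  linarith

/-- `x ≤ A + B`, `0 ≤ x` ⇒ `x² ≤ 2A² + 2B²`. [folklore] -/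
theorem sq_le_two_sq_add_two_sq {x A B : ℝ} (hx : 0 ≤ x) (h : x ≤ A + B) : x ^ 2 ≤ 2 * A ^ 2 + 2 * B ^ 2 := by
  nlinarith [sq_nonneg (A - B), pow_le_pow_left₀ hx h 2]

/-! ## §2 The oscillation of the comb-transported field on the block -/

/-- ★★ **THE OSCILLATION OF THE COMB-TRANSPORTED FIELD**: with `Xᵀ(y,μ) = R(V(Γ_{q,y}))X(y,μ)` and `X̄_μ = (n+1)⁻ᵈΣ_sXᵀ(q+s,μ)`,
`Σ_{s,μ}‖Xᵀ(q+s,μ) − X̄_μ‖² ≤ (N∕8)(n+1)²·(2·Σ_{μ,ν}Σ_{s:s_ν≠n}‖R(V(q+s,ν))X(q+s+e_ν,μ) − X(q+s,μ)‖² + 8d³n²a²·Σ_{s,μ}‖X(q+s,μ)‖²)` — the cube Poincaré inequality with the mean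
(F-6a-1 `sum_normSq_sub_mean_le`) per `μ`, and flat differences of `Xᵀ` = covariant differences up to `2dna‖X‖` (F-6a-1 ★`norm_conjR_tree_sub_le`).
[cite: Balaban1985Averaging, pp.24–25; Balaban1983RegularityDecay, (2.27) p.580] -/
theorem sum_normSq_combTransported_sub_mean_le (n : ℕ) (V : LSite d → Fin d → (Matrix (Fin N) (Fin N) ℂ)ˣ) (hV : ∀ x κ, V x κ ∈ U1 (Matrix (Fin N) (Fin N) ℂ))
    {a : ℝ} (ha : 0 ≤ a) (hplaq : ∀ (x : LSite d) (κ μ : Fin d), κ ≠ μ → ‖((hol V x (plaqWord κ μ) : (Matrix (Fin N) (Fin N) ℂ)ˣ) : Matrix (Fin N) (Fin N) ℂ) - 1‖ ≤ a)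
    (X : LSite d → Fin d → Matrix (Fin N) (Fin N) ℂ) (q : LSite d) :
    ∑ μ : Fin d, ∑ s : Fin d → Fin (n + 1), ‖conjR (hol V q (treeWord (boxVec (n + 1) s))) (X (q + boxVec (n + 1) s) μ)
        - (((n : ℝ) + 1) ^ d)⁻¹ • ∑ s' : Fin d → Fin (n + 1), conjR (hol V q (treeWord (boxVec (n + 1) s'))) (X (q + boxVec (n + 1) s') μ)‖ ^ 2
      ≤ N / 8 * ((n : ℝ) + 1) ^ 2 *
          (2 * ∑ μ : Fin d, ∑ ν : Fin d, ∑ s ∈ univ.filter (fun s : Fin d → Fin (n + 1) => s ν ≠ Fin.last n),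
                ‖conjR (V (q + boxVec (n + 1) s) ν) (X (q + boxVec (n + 1) s + e ν) μ) - X (q + boxVec (n + 1) s) μ‖ ^ 2
            + 8 * (d : ℝ) ^ 3 * (n : ℝ) ^ 2 * a ^ 2 * ∑ μ : Fin d, ∑ s : Fin d → Fin (n + 1), ‖X (q + boxVec (n + 1) s) μ‖ ^ 2) := by
  -- the transported field as a function on the cube, per direction
  set F : Fin d → (Fin d → Fin (n + 1)) → Matrix (Fin N) (Fin N) ℂ := fun μ s => conjR (hol V q (treeWord (boxVec (n + 1) s))) (X (q + boxVec (n + 1) s) μ) with hF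
  set G : Fin d → ℝ := fun μ => ∑ ν : Fin d, ∑ s ∈ univ.filter (fun s : Fin d → Fin (n + 1) => s ν ≠ Fin.last n),
      ‖conjR (V (q + boxVec (n + 1) s) ν) (X (q + boxVec (n + 1) s + e ν) μ) - X (q + boxVec (n + 1) s) μ‖ ^ 2 with hG
  set M : Fin d → ℝ := fun μ => ∑ s : Fin d → Fin (n + 1), ‖X (q + boxVec (n + 1) s) μ‖ ^ 2 with hM
  -- each flat difference of `F μ` is a covariant difference up to `2dna‖X‖`
  have hΔ : ∀ (μ ν : Fin d) (s : Fin d → Fin (n + 1)), s ν ≠ Fin.last n →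
      ‖F μ (stepUp s ν) - F μ s‖ ^ 2
        ≤ 2 * ‖conjR (V (q + boxVec (n + 1) s) ν) (X (q + boxVec (n + 1) s + e ν) μ) - X (q + boxVec (n + 1) s) μ‖ ^ 2
          + 2 * (2 * ((d : ℝ) * n * a) * ‖X (q + boxVec (n + 1) s) μ‖) ^ 2 := by
    intro μ ν s hs
    have hstep : boxVec (n + 1) (stepUp s ν) = boxVec (n + 1) s + e ν := intVec_stepUp s ν hs
    have h := norm_conjR_tree_sub_le V hV ha hplaq q (q + boxVec (n + 1) s) ν (X (q + boxVec (n + 1) s) μ) (X (q + boxVec (n + 1) s + e ν) μ)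
    rw [add_sub_cancel_left, show q + boxVec (n + 1) s + e ν - q = boxVec (n + 1) s + e ν by abel] at h
    have hl1 : (l1 (boxVec (n + 1) s) : ℝ) * a ≤ (d : ℝ) * n * a := mul_le_mul_of_nonneg_right (l1_intVec_le s) ha
    have hX0 : 0 ≤ ‖X (q + boxVec (n + 1) s) μ‖ := norm_nonneg _
    have hFs : F μ (stepUp s ν) - F μ s = conjR (hol V q (treeWord (boxVec (n + 1) s + e ν))) (X (q + boxVec (n + 1) s + e ν) μ)
        - conjR (hol V q (treeWord (boxVec (n + 1) s))) (X (q + boxVec (n + 1) s) μ) := by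
      simp only [hF, hstep, add_assoc]
    rw [hFs]
    refine sq_le_two_sq_add_two_sq (norm_nonneg _) (h.trans ?_)
    linarith [mul_le_mul_of_nonneg_right hl1 hX0]
  -- per direction: Poincaré with the mean, then the differences
  have hμ : ∀ μ : Fin d, ∑ s : Fin d → Fin (n + 1), ‖F μ s - (((n : ℝ) + 1) ^ d)⁻¹ • ∑ s', F μ s'‖ ^ 2 ≤ N / 8 * ((n : ℝ) + 1) ^ 2 * (2 * G μ + 8 * (d : ℝ) ^ 3 * (n : ℝ) ^ 2 * a ^ 2 * M μ) := by
    intro μ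
    refine (sum_normSq_sub_mean_le n (F μ)).trans (mul_le_mul_of_nonneg_left ?_ (by positivity))
    have hν : ∀ ν : Fin d, ∑ s ∈ univ.filter (fun s : Fin d → Fin (n + 1) => s ν ≠ Fin.last n), ‖F μ (stepUp s ν) - F μ s‖ ^ 2
        ≤ 2 * ∑ s ∈ univ.filter (fun s : Fin d → Fin (n + 1) => s ν ≠ Fin.last n),
              ‖conjR (V (q + boxVec (n + 1) s) ν) (X (q + boxVec (n + 1) s + e ν) μ) - X (q + boxVec (n + 1) s) μ‖ ^ 2
          + 8 * ((d : ℝ) * n * a) ^ 2 * M μ := by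
      intro ν
      have s1 : ∑ s ∈ univ.filter (fun s : Fin d → Fin (n + 1) => s ν ≠ Fin.last n), ‖F μ (stepUp s ν) - F μ s‖ ^ 2
          ≤ ∑ s ∈ univ.filter (fun s : Fin d → Fin (n + 1) => s ν ≠ Fin.last n),
              (2 * ‖conjR (V (q + boxVec (n + 1) s) ν) (X (q + boxVec (n + 1) s + e ν) μ) - X (q + boxVec (n + 1) s) μ‖ ^ 2
                + 2 * (2 * ((d : ℝ) * n * a) * ‖X (q + boxVec (n + 1) s) μ‖) ^ 2) :=
        Finset.sum_le_sum fun s hs => hΔ μ ν s (Finset.mem_filter.mp hs).2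
      have s2 : ∑ s ∈ univ.filter (fun s : Fin d → Fin (n + 1) => s ν ≠ Fin.last n), ‖X (q + boxVec (n + 1) s) μ‖ ^ 2 ≤ M μ :=
        Finset.sum_le_sum_of_subset_of_nonneg (Finset.filter_subset _ _) fun _ _ _ => sq_nonneg _
      have e1 : ∑ s ∈ univ.filter (fun s : Fin d → Fin (n + 1) => s ν ≠ Fin.last n),
          (2 * ‖conjR (V (q + boxVec (n + 1) s) ν) (X (q + boxVec (n + 1) s + e ν) μ) - X (q + boxVec (n + 1) s) μ‖ ^ 2
            + 2 * (2 * ((d : ℝ) * n * a) * ‖X (q + boxVec (n + 1) s) μ‖) ^ 2)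
          = 2 * ∑ s ∈ univ.filter (fun s : Fin d → Fin (n + 1) => s ν ≠ Fin.last n),
              ‖conjR (V (q + boxVec (n + 1) s) ν) (X (q + boxVec (n + 1) s + e ν) μ) - X (q + boxVec (n + 1) s) μ‖ ^ 2
            + 8 * ((d : ℝ) * n * a) ^ 2 * ∑ s ∈ univ.filter (fun s : Fin d → Fin (n + 1) => s ν ≠ Fin.last n), ‖X (q + boxVec (n + 1) s) μ‖ ^ 2 := by
        rw [Finset.sum_add_distrib, Finset.mul_sum, Finset.mul_sum]
        congr 1
        exact Finset.sum_congr rfl fun s _ => by ring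
      rw [e1] at s1
      have h8 : 0 ≤ 8 * ((d : ℝ) * n * a) ^ 2 := by positivity
      linarith [s1, mul_le_mul_of_nonneg_left s2 h8]
    have hsum := Finset.sum_le_sum fun ν (_ : ν ∈ (Finset.univ : Finset (Fin d))) => hν ν
    refine hsum.trans (le_of_eq ?_)
    rw [Finset.sum_add_distrib, ← Finset.mul_sum, Finset.sum_const, Finset.card_univ, Fintype.card_fin, nsmul_eq_mul, hG]
    ring
  -- sum over the directions
  have hsumμ := Finset.sum_le_sum fun μ (_ : μ ∈ (Finset.univ : Finset (Fin d))) => hμ μ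
  refine hsumμ.trans (le_of_eq ?_)
  conv_rhs => rw [Finset.mul_sum, Finset.mul_sum, ← Finset.sum_add_distrib, Finset.mul_sum]

/-! ## §3 The in-cell row -/

/-- ★★★ **THE COVARIANT IN-CELL ROW (PREREAD §1 (a) dressed; MASTER §1 row 6)**: for a `U1` background `V` on `ℤᵈ` whose unit plaquettes are within `a ≥ 0` of `1`, a level field `X`, a corner `q`
and the block `q + [0,n]ᵈ`, with `X̄_μ(q) := (n+1)⁻ᵈ Σ_s R(V(Γ_{q,q+s}))X(q+s, μ)` the comb-transported block means,
`‖F̂_V(q) − Σ_μ (n∕2)•X̄_μ(q)‖² ≤ (N∕2)·d²n²(n+1)²·Σ_{μ,ν}Σ_{s : s_ν ≠ n}‖R(V(q+s,ν))X(q+s+e_ν, μ) − X(q+s, μ)‖² + (8d⁶n⁶ + 2N·d⁵n⁴(n+1)²)·a²·Σ_{s,μ}‖X(q+s, μ)‖²`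
— the comb-tree functional minus its drift is an oscillation, priced by the covariant gradient energy on the block and `a²`× the block mass; constants polynomial in `(d, n, N)` only.
[cite: Balaban1985Averaging, (112) p.34, pp.24–25, (125)–(126) p.36; Balaban1983RegularityDecay, (2.27) p.580] -/
theorem norm_FhatCov_sub_drift_sq_le (n : ℕ) (V : LSite d → Fin d → (Matrix (Fin N) (Fin N) ℂ)ˣ) (hV : ∀ x κ, V x κ ∈ U1 (Matrix (Fin N) (Fin N) ℂ)) {a : ℝ} (ha : 0 ≤ a)
    (hplaq : ∀ (x : LSite d) (κ μ : Fin d), κ ≠ μ → ‖((hol V x (plaqWord κ μ) : (Matrix (Fin N) (Fin N) ℂ)ˣ) : Matrix (Fin N) (Fin N) ℂ) - 1‖ ≤ a)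
    (X : LSite d → Fin d → Matrix (Fin N) (Fin N) ℂ) (q : LSite d) :
    ‖FhatCov (n + 1) V X q
        - ∑ μ : Fin d, ((n : ℝ) / 2) • ((((n : ℝ) + 1) ^ d)⁻¹ • ∑ s : Fin d → Fin (n + 1), conjR (hol V q (treeWord (boxVec (n + 1) s))) (X (q + boxVec (n + 1) s) μ))‖ ^ 2
      ≤ N / 2 * (d : ℝ) ^ 2 * (n : ℝ) ^ 2 * ((n : ℝ) + 1) ^ 2 *
          ∑ μ : Fin d, ∑ ν : Fin d, ∑ s ∈ univ.filter (fun s : Fin d → Fin (n + 1) => s ν ≠ Fin.last n),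
            ‖conjR (V (q + boxVec (n + 1) s) ν) (X (q + boxVec (n + 1) s + e ν) μ) - X (q + boxVec (n + 1) s) μ‖ ^ 2
        + (8 * (d : ℝ) ^ 6 * (n : ℝ) ^ 6 + 2 * N * (d : ℝ) ^ 5 * (n : ℝ) ^ 4 * ((n : ℝ) + 1) ^ 2) * a ^ 2 *
          ∑ s : Fin d → Fin (n + 1), ∑ μ : Fin d, ‖X (q + boxVec (n + 1) s) μ‖ ^ 2 := by
  -- names
  set T : LSite d → (Matrix (Fin N) (Fin N) ℂ)ˣ := fun y => hol V q (treeWord (y - q)) with hT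
  set XT : LSite d → Fin d → Matrix (Fin N) (Fin N) ℂ := fun y μ => conjR (T y) (X y μ) with hXT
  set w : ℝ := (((n : ℝ) + 1) ^ d)⁻¹ with hw
  set Xbar : Fin d → Matrix (Fin N) (Fin N) ℂ := fun μ => w • ∑ s : Fin d → Fin (n + 1), XT (q + boxVec (n + 1) s) μ with hXbar
  set XB : LSite d → Fin d → Matrix (Fin N) (Fin N) ℂ := fun _ μ => Xbar μ with hXB
  set MX : ℝ := ∑ s : Fin d → Fin (n + 1), ∑ μ : Fin d, ‖X (q + boxVec (n + 1) s) μ‖ ^ 2 with hMX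
  set OSC : ℝ := ∑ s : Fin d → Fin (n + 1), ∑ μ : Fin d, ‖XT (q + boxVec (n + 1) s) μ - Xbar μ‖ ^ 2 with hOSC
  set GRAD : ℝ := ∑ μ : Fin d, ∑ ν : Fin d, ∑ s ∈ univ.filter (fun s : Fin d → Fin (n + 1) => s ν ≠ Fin.last n),
      ‖conjR (V (q + boxVec (n + 1) s) ν) (X (q + boxVec (n + 1) s + e ν) μ) - X (q + boxVec (n + 1) s) μ‖ ^ 2 with hGRAD
  set S : Set (LSite d) := {y : LSite d | ∀ i, q i ≤ y i ∧ y i ≤ q i + n} with hS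
  have hXTq : ∀ (s : Fin d → Fin (n + 1)) (μ : Fin d), XT (q + boxVec (n + 1) s) μ = conjR (hol V q (treeWord (boxVec (n + 1) s))) (X (q + boxVec (n + 1) s) μ) := by
    intro s μ; simp only [hXT, hT, add_sub_cancel_left]
  have hw0 : 0 < w := by rw [hw]; positivity
  have hwcard : w * ((n : ℝ) + 1) ^ d = 1 := by rw [hw]; exact inv_mul_cancel₀ (by positivity)
  have hL : ((((n + 1 : ℕ) : ℝ)) ^ d)⁻¹ = w := by rw [hw]; push_cast; ring
  have hdn : (0 : ℝ) ≤ d * n := by positivity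
  have hMX0 : 0 ≤ MX := Finset.sum_nonneg fun _ _ => Finset.sum_nonneg fun _ _ => sq_nonneg _
  have hOSC0 : 0 ≤ OSC := Finset.sum_nonneg fun _ _ => Finset.sum_nonneg fun _ _ => sq_nonneg _
  have hGRAD0 : 0 ≤ GRAD := Finset.sum_nonneg fun _ _ => Finset.sum_nonneg fun _ _ => Finset.sum_nonneg fun _ _ => sq_nonneg _
  -- the drift in terms of `Xbar`
  have hdrift : ∑ μ : Fin d, ((n : ℝ) / 2) • ((((n : ℝ) + 1) ^ d)⁻¹ • ∑ s : Fin d → Fin (n + 1), conjR (hol V q (treeWord (boxVec (n + 1) s))) (X (q + boxVec (n + 1) s) μ))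
      = ∑ μ : Fin d, ((n : ℝ) / 2) • Xbar μ := Finset.sum_congr rfl fun μ _ => by simp only [hXbar, hXTq, hw]
  rw [hdrift]
  -- STEP 1: per tree word, the rotated sum versus the abelian functional of `XT`, and the oscillation part
  have hper : ∀ r : Fin d → Fin (n + 1),
      ‖tsum V X q (treeWord (boxVec (n + 1) r)) - asum XB q (treeWord (boxVec (n + 1) r))‖ ≤ 2 * ((d : ℝ) * n) ^ 3 * a * Real.sqrt MX + (d : ℝ) * n * Real.sqrt OSC := by
    intro r
    have hpos := treeWord_boxVec_pos (d := d) r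
    have hP := pathIn_treeWord_boxVec (d := d) q r
    have hlen := length_treeWord_boxVec_le (d := d) r
    have hlen0 : (0 : ℝ) ≤ (treeWord (boxVec (n + 1) r)).length := Nat.cast_nonneg _
    -- transport part
    have h1 := norm_conjR_tsum_sub_asum_le V hV ha hplaq X q hdn (fun y hy => l1_sub_le_of_mem_box hy) q (treeWord (boxVec (n + 1) r)) hpos hP 1
      (Subgroup.one_mem _) 0 (by rw [sub_self, treeWord_zero, hol_nil, Units.val_one, sub_self, norm_zero])
    rw [one_conjR, zero_add] at h1
    have hmass : asum (fun y μ => ‖X y μ‖) q (treeWord (boxVec (n + 1) r)) ≤ (treeWord (boxVec (n + 1) r)).length * Real.sqrt MX := by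
      have h := norm_asum_le_length_mul (fun y μ => ‖X y μ‖) (S := S) (M := Real.sqrt MX)
        (fun y hy μ => by rw [Real.norm_eq_abs, abs_norm]; exact norm_le_sqrt_blockSum X hy μ) q _ hpos hP
      exact (le_abs_self _).trans ((Real.norm_eq_abs _).symm.le.trans h)
    -- oscillation part
    have h2 : ‖asum (XT - XB) q (treeWord (boxVec (n + 1) r))‖ ≤ (treeWord (boxVec (n + 1) r)).length * Real.sqrt OSC :=
      norm_asum_le_length_mul (XT - XB) (S := S) (M := Real.sqrt OSC)
        (fun y hy μ => by simpa only [Pi.sub_apply, hXB] using norm_le_sqrt_blockSum (fun y μ => XT y μ - Xbar μ) hy μ) q _ hpos hP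
    -- combine
    have hsplit : tsum V X q (treeWord (boxVec (n + 1) r)) - asum XB q (treeWord (boxVec (n + 1) r))
        = (tsum V X q (treeWord (boxVec (n + 1) r)) - asum XT q (treeWord (boxVec (n + 1) r))) + asum (XT - XB) q (treeWord (boxVec (n + 1) r)) := by
      rw [asum_sub]; abel
    rw [hsplit]
    refine (norm_add_le _ _).trans (add_le_add (h1.trans ?_) (h2.trans ?_))
    · have hsq0 : 0 ≤ Real.sqrt MX := Real.sqrt_nonneg _
      have hm0 : 0 ≤ asum (fun y μ => ‖X y μ‖) q (treeWord (boxVec (n + 1) r)) := asum_nonneg _ (fun _ _ => norm_nonneg _) _ _ hpos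
      have hdna : 0 ≤ (d : ℝ) * n * a := mul_nonneg hdn ha
      have hc1 : 2 * ((treeWord (boxVec (n + 1) r)).length * ((d : ℝ) * n * a)) ≤ 2 * ((d : ℝ) * n * ((d : ℝ) * n * a)) :=
        mul_le_mul_of_nonneg_left (mul_le_mul_of_nonneg_right hlen hdna) (by norm_num)
      have hc2 : asum (fun y μ => ‖X y μ‖) q (treeWord (boxVec (n + 1) r)) ≤ (d : ℝ) * n * Real.sqrt MX :=
        hmass.trans (mul_le_mul_of_nonneg_right hlen hsq0)
      calc 2 * ((treeWord (boxVec (n + 1) r)).length * ((d : ℝ) * n * a)) * asum (fun y μ => ‖X y μ‖) q (treeWord (boxVec (n + 1) r))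
          ≤ 2 * ((d : ℝ) * n * ((d : ℝ) * n * a)) * ((d : ℝ) * n * Real.sqrt MX) :=
            mul_le_mul hc1 hc2 hm0 (mul_nonneg (by norm_num) (mul_nonneg hdn hdna))
        _ = 2 * ((d : ℝ) * n) ^ 3 * a * Real.sqrt MX := by ring
    · exact mul_le_mul_of_nonneg_right hlen (Real.sqrt_nonneg _)
  -- STEP 2: the drift identity and the average over `r`
  have hFhat : FhatCov (n + 1) V X q - ∑ μ : Fin d, ((n : ℝ) / 2) • Xbar μ
      = ∑ r : Fin d → Fin (n + 1), w • (tsum V X q (treeWord (boxVec (n + 1) r)) - asum XB q (treeWord (boxVec (n + 1) r))) := by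
    have hB : ∀ r : Fin d → Fin (n + 1), asum XB q (treeWord (boxVec (n + 1) r)) = ∑ μ : Fin d, ((r μ : ℕ) : ℝ) • Xbar μ :=
      fun r => asum_const_treeWord_boxVec Xbar q r
    have hB' : ∑ r : Fin d → Fin (n + 1), w • asum XB q (treeWord (boxVec (n + 1) r)) = ∑ μ : Fin d, ((n : ℝ) / 2) • Xbar μ := by
      have h1 : ∑ r : Fin d → Fin (n + 1), w • asum XB q (treeWord (boxVec (n + 1) r))
          = ∑ r : Fin d → Fin (n + 1), ∑ μ : Fin d, (w * ((r μ : ℕ) : ℝ)) • Xbar μ :=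
        Finset.sum_congr rfl fun r _ => by rw [hB r, Finset.smul_sum]; exact Finset.sum_congr rfl fun μ _ => smul_smul _ _ _
      rw [h1, Finset.sum_comm]
      refine Finset.sum_congr rfl fun μ _ => ?_
      rw [← Finset.sum_smul, ← Finset.mul_sum, sum_coord]
    have hF : FhatCov (n + 1) V X q = ∑ r : Fin d → Fin (n + 1), w • tsum V X q (treeWord (boxVec (n + 1) r)) := by
      rw [FhatCov, hL]
    rw [hF, ← hB', ← Finset.sum_sub_distrib]
    exact Finset.sum_congr rfl fun r _ => (smul_sub _ _ _).symm
  rw [hFhat]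
  have hnorm : ‖∑ r : Fin d → Fin (n + 1), w • (tsum V X q (treeWord (boxVec (n + 1) r)) - asum XB q (treeWord (boxVec (n + 1) r)))‖
      ≤ 2 * ((d : ℝ) * n) ^ 3 * a * Real.sqrt MX + (d : ℝ) * n * Real.sqrt OSC := by
    refine (norm_sum_le _ _).trans ?_
    calc ∑ r : Fin d → Fin (n + 1), ‖w • (tsum V X q (treeWord (boxVec (n + 1) r)) - asum XB q (treeWord (boxVec (n + 1) r)))‖
        ≤ ∑ _r : Fin d → Fin (n + 1), w * (2 * ((d : ℝ) * n) ^ 3 * a * Real.sqrt MX + (d : ℝ) * n * Real.sqrt OSC) :=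
          Finset.sum_le_sum fun r _ => by rw [norm_smul, Real.norm_eq_abs, abs_of_pos hw0]; exact mul_le_mul_of_nonneg_left (hper r) hw0.le
      _ = 2 * ((d : ℝ) * n) ^ 3 * a * Real.sqrt MX + (d : ℝ) * n * Real.sqrt OSC := by
          rw [Finset.sum_const, Finset.card_univ, nsmul_eq_mul, Fintype.card_fun, Fintype.card_fin, Fintype.card_fin]
          push_cast
          rw [← mul_assoc, mul_comm _ w, hwcard, one_mul]
  -- STEP 3: the oscillation (§2)
  have hOSC : OSC ≤ N / 8 * ((n : ℝ) + 1) ^ 2 * (2 * GRAD + 8 * (d : ℝ) ^ 3 * (n : ℝ) ^ 2 * a ^ 2 * MX) := by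
    have h := sum_normSq_combTransported_sub_mean_le n V hV ha hplaq X q
    have hO : OSC = ∑ μ : Fin d, ∑ s : Fin d → Fin (n + 1), ‖conjR (hol V q (treeWord (boxVec (n + 1) s))) (X (q + boxVec (n + 1) s) μ)
        - (((n : ℝ) + 1) ^ d)⁻¹ • ∑ s' : Fin d → Fin (n + 1), conjR (hol V q (treeWord (boxVec (n + 1) s'))) (X (q + boxVec (n + 1) s') μ)‖ ^ 2 := by
      rw [hOSC, Finset.sum_comm]
      simp only [hXbar, hXTq, hw]
    have hM : ∑ μ : Fin d, ∑ s : Fin d → Fin (n + 1), ‖X (q + boxVec (n + 1) s) μ‖ ^ 2 = MX := by rw [hMX, Finset.sum_comm]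
    rw [hO, ← hM, hGRAD]
    exact h
  -- STEP 4: assemble
  have hsq : ‖∑ r : Fin d → Fin (n + 1), w • (tsum V X q (treeWord (boxVec (n + 1) r)) - asum XB q (treeWord (boxVec (n + 1) r)))‖ ^ 2
      ≤ 2 * (2 * ((d : ℝ) * n) ^ 3 * a) ^ 2 * MX + 2 * ((d : ℝ) * n) ^ 2 * OSC := by
    have h1 := sq_le_two_sq_add_two_sq (norm_nonneg _) hnorm
    rw [mul_pow (2 * ((d : ℝ) * n) ^ 3 * a), Real.sq_sqrt hMX0, mul_pow ((d : ℝ) * n), Real.sq_sqrt hOSC0] at h1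
    linarith [h1]
  have hc : 0 ≤ 2 * ((d : ℝ) * n) ^ 2 := by positivity
  calc _ ≤ 2 * (2 * ((d : ℝ) * n) ^ 3 * a) ^ 2 * MX + 2 * ((d : ℝ) * n) ^ 2 * OSC := hsq
    _ ≤ 2 * (2 * ((d : ℝ) * n) ^ 3 * a) ^ 2 * MX + 2 * ((d : ℝ) * n) ^ 2 * (N / 8 * ((n : ℝ) + 1) ^ 2 * (2 * GRAD + 8 * (d : ℝ) ^ 3 * (n : ℝ) ^ 2 * a ^ 2 * MX)) :=
        add_le_add le_rfl (mul_le_mul_of_nonneg_left hOSC hc)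
    _ = _ := by ring

end Summit.QuantumFields.YangMills.Theorems.Prop7CornerCombInCellPoincare
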